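import Literature.Geometry.Kaehler.ComplexTorusHardLefschetzMinimalClassModPrimeKernel
import Literature.LinearAlgebra.Alternating.WedgeWordsDet
import HarnessLib

/-!
# Integral classes of a complex torus have even cup squares: `x ∧ x ∈ 2·H²ᵏ(X, ℤ)` for `x ∈ Hᵏ(X, ℤ)`, `k ≥ 1`;
# the Lefschetz forms `(x, y) ↦ ⟨x, γ ∧ y⟩` on `Hᵏ(X, ℤ)` are EVEN (`k` even) resp. ALTERNATING (`k` odd)

Layer `Literature/Geometry/Kaehler`, namespace `Literature.Geometry.Kaehler.ComplexTorus`; lane `lit-hodgefound` (Track 2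
foundations library), seat p09, generation 41, row g41-#4. THEOREMS ONLY (0 definitions); no named fact, net debt 0. Sequel of
g41-#1 `ComplexTorusIntegralLefschetzFormsDiscriminant` (`|disc|` of the integral Lefschetz forms), g41-#3
`ComplexTorusHardLefschetzMinimalClassModPrimeImage` (the degree-two Lefschetz forms are symmetric) and g29-#7
`ComplexTorusMiddleIntegralCupFormEven` (the MIDDLE cup form of an even-dimensional torus is even — proved there by an isotropic
splitting; §2 below gives the general statement by a different route).

Sources (the statements being made precise over `ℤ`):

* Lange 2023 §1.1.3 Lemma 1.1.17 (b) and Exercise 1.1.6 (7), §1.1.4 Prop. 1.1.20: the cup product identifies `H•(X, ℤ)` with the EXTERIOR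
  algebra `⋀• Hom(Λ, ℤ)` on the classes `dx_I` of the increasing lattice monomials — so for `x = Σ_I x_I dx_I ∈ Hᵏ(X, ℤ)`:
  `x ∧ x = Σ_{I ≠ J} x_I x_J dx_I ∧ dx_J` (`dx_I ∧ dx_I = 0`), which is `2 Σ_{I<J} x_I x_J dx_I ∧ dx_J` for `k` even (`dx_J ∧ dx_I = dx_I ∧ dx_J`)
  and `0` for `k` odd; §6.2.4 (PDF p. 310: the cup-product pairing `Hᵖ(X, ℤ) ⊗ H^{2g−p}(X, ℤ) → ℤ`); §2.5.3 Cor. 2.5.17 (PDF p. 135) and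
  §5.4.1 (5.22) (PDF p. 275) for the minimal classes `γ_q = θ^{∧q}/(q!·d₁⋯d_q)`;
* Huybrechts 2016 Ch. 14 §0.1 (PDF p. 330 L21–L25): "A lattice `Λ` is called *even* if `(x)² := (x.x) ∈ 2ℤ` for all `x ∈ Λ`"; Ch. 3 §2.3
  (PDF p. 59): `H²(A, ℤ) ≃ U^{⊕3}` for a complex `2`-torus (the case `g = 2`, `k = 2`, `γ = 1`);
* Warner GTM94, 2.6 (graded commutativity / associativity of `∧`; the tree's `WedgeComm_holds`, `WedgeAssoc_holds`).

(Context, not formalized: on a general closed oriented manifold the mod-`2` cup square is `x ∪ x ≡ v_k ∪ x`, `v_k` the Wu class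
[cite: MilnorStasheffAMS76, §11]; all Wu classes of a torus vanish, and §1 is the integral form of this for `H•(X, ℤ) = ⋀• ℤ^{2g}`.)

## Contents

* §0 (linear algebra of complex-valued forms) graded commutativity in equal degrees: `β ∧ α = α ∧ β` (`k` even), `β ∧ α = −α ∧ β` and
  `x ∧ x = 0` (`k` odd); `x ∧ (γ ∧ x) = (x ∧ x) ∧ γ` up to reindexing (`k` even), `x ∧ (γ ∧ x) = 0` (`k` odd).
* §1 (ANY complex torus `X = E/Φ(ℤ^ι)`) `dx_I ∧ dx_I = 0` for every lattice monomial of positive degree, and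
  **`exists_mem_integralForms_wedge_self_eq_two_smul`: for `x ∈ Hᵏ(X, ℤ)`, `k ≥ 1`, there is `y ∈ H²ᵏ(X, ℤ)` with `x ∧ x = 2·y`** —
  induction over the monomial expansion: `(x_I dx_I + u) ∧ (x_I dx_I + u) = x_I² dx_I ∧ dx_I + 2 x_I dx_I ∧ u + u ∧ u` (`k` even).
* §2 **`exists_int_poincarePairing_wedge_self_eq_two_mul`: `⟨x, γ ∧ x⟩ ∈ 2ℤ` for `x ∈ Hᵏ(X, ℤ)` (`k ≥ 1`) and every integral `γ ∈ Hᵐ(X, ℤ)`**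
  (`k + (m + k) = 2 dim X`, any orientation): for `k` even `⟨x, γ ∧ x⟩ = 2⟨y, γ⟩` (`poincarePairing_wedge_self_eq_two_mul_of_even`), for `k`
  odd `⟨x, γ ∧ x⟩ = 0` (`poincarePairing_wedge_self_eq_zero_of_odd`: the Lefschetz forms on odd cohomology are alternating). Hence the
  Gram matrix `(⟨b_i, γ ∧ b_{i'}⟩)` of g41-#1 on any family `b` in `Hᵏ(X, ℤ)` has EVEN DIAGONAL (`two_dvd_of_eq_poincarePairing_wedge_self`).
* §3 For a polarised torus of type `(d₁, …, d_g)` (`g = j + 2`) and the minimal class `γ_q` (integral, g40-#6 §1), `k = g − q ≥ 1`: **the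
  integral Lefschetz form `(x, y) ↦ ∫ x ∧ γ_q ∧ y` on `Hᵏ(X, ℤ)` takes even values on the diagonal** — for `k` even an EVEN symmetric
  lattice; with g41-#1/#3 in degree two: even, symmetric, of `|disc| = (g−1)·∏_{i ≤ g−2} ((d_{g−1}/d_i)(d_g/d_i))^{2g−1}`; e.g. for a principally
  polarised threefold `(H²(X, ℤ), ∫ θ ∧ x ∧ y)` is an even lattice of rank `15` and discriminant `±2` (`IsSymplecticEnum.…`, `IsPolarizationType.…`).

## References

* [cite: Lange2023AbelianVarietiesComplex, §1.1.3 Lemma 1.1.17 (b) and Exercise 1.1.6 (7); §1.1.4 Prop. 1.1.20; §6.2.4 (PDF p. 310); §2.5.3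
  Cor. 2.5.17 (PDF p. 135); §5.4.1 (5.22) (PDF p. 275); §1.5.1 (PDF p. 51)]
* [cite: Huybrechts2016K3, Ch. 14 §0.1 (PDF p. 330 L21–L25); Ch. 3 §2.3 (PDF p. 59)]
* [cite: WarnerGTM94, 2.6]
* [cite: MilnorStasheffAMS76, §11] (context only)
-/

noncomputable section

open Module Function
open Literature.LinearAlgebra.Alternating

namespace Literature.Geometry.Kaehler.ComplexTorus

/-! ## §0 Graded commutativity in equal degrees; `x ∧ (γ ∧ x)` -/

section WedgeSquares

variable {E : Type*} [NormedAddCommGroup E] [NormedSpace ℂ E] {k m : ℕ}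

/-- Two complex-valued forms of the same EVEN degree commute on the nose: `β ∧ α = α ∧ β` (`(-1)^{k·k} = 1`; the degree-two case is
`wedge_comm_two_two_complex` of `ComplexTorusRefinedHumbertInvariant`, not imported here). [cite: WarnerGTM94, 2.6] -/
theorem wedge_comm_of_even_complex (hk : Even k) (α β : E [⋀^Fin k]→L[ℝ] ℂ) : β.wedge α = α.wedge β := by
  rw [ContinuousAlternatingMap.WedgeComm_holds ℝ E ℂ α β, (hk.mul_right k).neg_one_pow, one_smul, domDomCongr_finCongr_self]

/-- Two complex-valued forms of the same ODD degree anticommute: `β ∧ α = −α ∧ β` (real-valued version: `wedge_comm_of_odd` of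
`ComplexTorusLazzeriJacobian`). [cite: WarnerGTM94, 2.6] -/
theorem wedge_comm_of_odd_complex (hk : Odd k) (α β : E [⋀^Fin k]→L[ℝ] ℂ) : β.wedge α = -α.wedge β := by
  rw [ContinuousAlternatingMap.WedgeComm_holds ℝ E ℂ α β, (hk.mul hk).neg_one_pow, domDomCongr_finCongr_self]
  ext v
  simp

/-- `x ∧ x = 0` for a complex-valued form of ODD degree (real-valued version: `wedge_self_eq_zero_of_odd` of `ComplexTorusLazzeriJacobian`).
[cite: WarnerGTM94, 2.6] -/
theorem wedge_self_eq_zero_of_odd_complex (hk : Odd k) (x : E [⋀^Fin k]→L[ℝ] ℂ) : x.wedge x = 0 := by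
  have h := wedge_comm_of_odd_complex hk x x
  ext v
  have hv := congrArg (fun F ↦ F v) h
  simp only [ContinuousAlternatingMap.neg_apply] at hv
  rw [ContinuousAlternatingMap.coe_zero, Pi.zero_apply]
  linear_combination hv / 2

/-- **`x ∧ (γ ∧ x) = (x ∧ x) ∧ γ` up to the reindexing `(k + k) + m = k + (m + k)`, for `x` of EVEN degree `k`** (graded commutativity
`γ ∧ x = x ∧ γ`, then associativity). [cite: WarnerGTM94, 2.6] -/
theorem wedge_wedge_self_eq_domDomCongr_of_even (hk : Even k) (x : E [⋀^Fin k]→L[ℝ] ℂ) (γ : E [⋀^Fin m]→L[ℝ] ℂ) :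
    x.wedge (γ.wedge x) = ((x.wedge x).wedge γ).domDomCongr (finCongr (by omega : (k + k) + m = k + (m + k))) := by
  have h1 : γ.wedge x = (x.wedge γ).domDomCongr (finCongr (Nat.add_comm k m)) := by
    rw [ContinuousAlternatingMap.WedgeComm_holds ℝ E ℂ x γ, (hk.mul_right m).neg_one_pow, one_smul]
  have h2 : x.wedge (x.wedge γ) = ((x.wedge x).wedge γ).domDomCongr (finCongr (Nat.add_assoc k k m)) := by
    rw [ContinuousAlternatingMap.WedgeAssoc_holds ℝ E ℂ x x γ, domDomCongr_finCongr_trans, domDomCongr_finCongr_self]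
  rw [h1, wedge_domDomCongr_finCongr, h2, domDomCongr_finCongr_trans]

/-- **`x ∧ (γ ∧ x) = 0` for `x` of ODD degree** (`γ ∧ x = ±x ∧ γ`, associativity, `x ∧ x = 0`). [cite: WarnerGTM94, 2.6] -/
theorem wedge_wedge_self_eq_zero_of_odd (hk : Odd k) (x : E [⋀^Fin k]→L[ℝ] ℂ) (γ : E [⋀^Fin m]→L[ℝ] ℂ) : x.wedge (γ.wedge x) = 0 := by
  have h2 : x.wedge (x.wedge γ) = ((x.wedge x).wedge γ).domDomCongr (finCongr (Nat.add_assoc k k m)) := by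
    rw [ContinuousAlternatingMap.WedgeAssoc_holds ℝ E ℂ x x γ, domDomCongr_finCongr_trans, domDomCongr_finCongr_self]
  rw [ContinuousAlternatingMap.WedgeComm_holds ℝ E ℂ x γ, ContinuousAlternatingMap.wedge_smul_right, wedge_domDomCongr_finCongr, h2,
    wedge_self_eq_zero_of_odd_complex hk, ContinuousAlternatingMap.zero_wedge]
  ext v
  simp

end WedgeSquares

section EvenLattice

variable {ι : Type*} [Fintype ι] [DecidableEq ι] {E : Type*} [NormedAddCommGroup E] [NormedSpace ℂ E]
  (Φ : (ι → ℝ) ≃L[ℝ] E) {k n : ℕ}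

/-! ## §1 `x ∧ x ∈ 2·H²ᵏ(X, ℤ)` for `x ∈ Hᵏ(X, ℤ)`, `k ≥ 1` -/

omit [Fintype ι] [DecidableEq ι] in
/-- `dx_I ∧ dx_I = 0` for every lattice monomial of positive degree (the word `I ++ I` repeats its first letter). [cite: WarnerGTM94, 2.6]
[cite: Lange2023AbelianVarietiesComplex, §1.1.3 Lemma 1.1.17 (b)] -/
theorem latMonomial_wedge_self_eq_zero (hk : k ≠ 0) (w : Fin k → ι) : (latMonomial Φ k w).wedge (latMonomial Φ k w) = 0 := by
  rw [latMonomial_wedge_latMonomial, latMonomial_eq]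
  refine wedgeWord_eq_zero_of_not_injective _ _ _ fun hinj ↦ ?_
  have h0 : 0 < k := Nat.pos_of_ne_zero hk
  have h := @hinj (Fin.castAdd k ⟨0, h0⟩) (Fin.natAdd k ⟨0, h0⟩) (by rw [Fin.append_left, Fin.append_right])
  have hv := congrArg Fin.val h
  simp only [Fin.val_castAdd, Fin.val_natAdd] at hv
  omega

/-- **Integral classes have even cup squares**: for ANY complex torus `X = E/Φ(ℤ^ι)`, `k ≥ 1` and `x ∈ Hᵏ(X, ℤ)` there is `y ∈ H²ᵏ(X, ℤ)` with
`x ∧ x = 2·y` — `H•(X, ℤ) = ⋀• Hom(Λ, ℤ)` is an exterior algebra: writing `x = Σ_I x_I dx_I` over increasing `k`-words,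
`x ∧ x = Σ_{I ≠ J} x_I x_J dx_I ∧ dx_J` (`dx_I ∧ dx_I = 0`), `= 2 Σ_{I<J} x_I x_J dx_I ∧ dx_J` for `k` even (even forms commute) and `= 0` for `k` odd.
Proof by induction over the monomial expansion. (False for `k = 0`: `1 ∧ 1 = 1`.) [cite: Lange2023AbelianVarietiesComplex, §1.1.3 Lemma 1.1.17 (b) and Exercise 1.1.6 (7); §1.1.4 Prop. 1.1.20] [cite: Huybrechts2016K3, Ch. 14 §0.1 (PDF p. 330 L21–L25)] -/
theorem exists_mem_integralForms_wedge_self_eq_two_smul (hk : k ≠ 0) {x : E [⋀^Fin k]→L[ℝ] ℂ} (hx : x ∈ integralForms Φ k) :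
    ∃ y ∈ integralForms Φ (k + k), x.wedge x = (2 : ℂ) • y := by
  classical
  obtain hko | hke := (Nat.even_or_odd k).symm
  · refine ⟨0, zero_mem _, ?_⟩
    rw [wedge_self_eq_zero_of_odd_complex hko]
    ext v
    simp
  letI : LinearOrder ι := LinearOrder.lift' (Fintype.equivFin ι) (Fintype.equivFin ι).injective
  choose z hz using exists_int_repr_eq_of_mem_integralForms Φ hx
  have hx_eq : x = ∑ w : {w : Fin k → ι // StrictMono w}, (z w : ℂ) • latMonomial Φ k w.1 := by
    conv_lhs => rw [← (latMonomialBasis Φ k).sum_repr x]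
    exact Finset.sum_congr rfl fun w _ ↦ by rw [hz w, latMonomialBasis_apply]
  suffices hS : ∀ s : Finset {w : Fin k → ι // StrictMono w}, ∃ y ∈ integralForms Φ (k + k),
      (∑ w ∈ s, (z w : ℂ) • latMonomial Φ k w.1).wedge (∑ w ∈ s, (z w : ℂ) • latMonomial Φ k w.1) = (2 : ℂ) • y by
    obtain ⟨y, hy, h⟩ := hS Finset.univ
    exact ⟨y, hy, by rw [hx_eq]; exact h⟩
  intro s
  induction s using Finset.induction_on with
  | empty =>
    refine ⟨0, zero_mem _, ?_⟩
    rw [Finset.sum_empty, ContinuousAlternatingMap.zero_wedge]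
    ext v
    simp
  | insert w s hw ih =>
    obtain ⟨y₀, hy₀, h₀⟩ := ih
    have huZ : ∑ w ∈ s, (z w : ℂ) • latMonomial Φ k w.1 ∈ integralForms Φ k :=
      sum_mem fun w _ ↦ intCast_smul_mem_integralForms Φ (latMonomial_mem_integralForms Φ k w.1) (z w)
    refine ⟨(z w : ℂ) • (latMonomial Φ k w.1).wedge (∑ w ∈ s, (z w : ℂ) • latMonomial Φ k w.1) + y₀,
      add_mem (intCast_smul_mem_integralForms Φ (wedge_mem_integralForms Φ (latMonomial_mem_integralForms Φ k w.1) huZ) (z w)) hy₀, ?_⟩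
    rw [Finset.sum_insert hw, ContinuousAlternatingMap.wedge_add_left, ContinuousAlternatingMap.wedge_add_right,
      ContinuousAlternatingMap.wedge_add_right, h₀, wedge_smul_left_complex, wedge_smul_left_complex, wedge_smul_right_complex,
      wedge_smul_right_complex, latMonomial_wedge_self_eq_zero Φ hk, wedge_comm_of_even_complex hke (latMonomial Φ k w.1)]
    ext v
    simp only [ContinuousAlternatingMap.add_apply, ContinuousAlternatingMap.smul_apply, ContinuousAlternatingMap.coe_zero,
      Pi.zero_apply, smul_zero, zero_add, smul_add, two_smul]
    abel

/-! ## §2 The Lefschetz forms `(x, y) ↦ ⟨x, γ ∧ y⟩` on `Hᵏ(X, ℤ)`: even for `k` even, alternating for `k` odd -/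

omit [Fintype ι] in
/-- **`⟨x, γ ∧ x⟩ = 2·⟨y, γ⟩` whenever `x ∧ x = 2·y`, `x` of EVEN degree `k`** (`k + (m + k) = n`, `(k + k) + m = n`, any orientation `e`).
[cite: WarnerGTM94, 2.6] [cite: Lange2023AbelianVarietiesComplex, §6.2.4 (PDF p. 310)] -/
theorem poincarePairing_wedge_self_eq_two_mul_of_even (hk : Even k) (e : Fin n ≃ ι) {m : ℕ} (hn : k + (m + k) = n)
    (h' : (k + k) + m = n) {x : E [⋀^Fin k]→L[ℝ] ℂ} (γ : E [⋀^Fin m]→L[ℝ] ℂ) {y : E [⋀^Fin (k + k)]→L[ℝ] ℂ}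
    (hxx : x.wedge x = (2 : ℂ) • y) : poincarePairing Φ e hn x (γ.wedge x) = 2 * poincarePairing Φ e h' y γ := by
  rw [poincarePairing_apply, poincarePairing_apply, wedge_wedge_self_eq_domDomCongr_of_even hk, hxx, wedge_smul_left_complex,
    domDomCongr_finCongr_smul, ContinuousAlternatingMap.smul_apply, smul_eq_mul]
  rfl

omit [Fintype ι] in
/-- **The Lefschetz forms on ODD cohomology are alternating: `⟨x, γ ∧ x⟩ = 0` for `x` of odd degree** (any `γ`, any orientation).
[cite: WarnerGTM94, 2.6] [cite: Lange2023AbelianVarietiesComplex, §6.2.4 (PDF p. 310)] -/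
theorem poincarePairing_wedge_self_eq_zero_of_odd (hk : Odd k) (e : Fin n ≃ ι) {m : ℕ} (hn : k + (m + k) = n)
    (x : E [⋀^Fin k]→L[ℝ] ℂ) (γ : E [⋀^Fin m]→L[ℝ] ℂ) : poincarePairing Φ e hn x (γ.wedge x) = 0 := by
  rw [poincarePairing_apply, wedge_wedge_self_eq_zero_of_odd hk, ContinuousAlternatingMap.coe_zero, Pi.zero_apply]

/-- **The Lefschetz forms on `Hᵏ(X, ℤ)` take even values on the diagonal: `⟨x, γ ∧ x⟩ ∈ 2ℤ` for `x ∈ Hᵏ(X, ℤ)`, `k ≥ 1`, and every integral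
class `γ ∈ Hᵐ(X, ℤ)`** (`k + (m + k) = 2 dim X`, any complex torus, any orientation): for `k` even `x ∧ x = 2·y` with `y ∈ H²ᵏ(X, ℤ)` (§1) and
`⟨x, γ ∧ x⟩ = 2⟨y, γ⟩ ∈ 2ℤ`; for `k` odd `⟨x, γ ∧ x⟩ = 0`. For `γ = 1` on a `2`-torus this is the evenness of `H²(X, ℤ) ≅ U^{⊕3}`.
[cite: Lange2023AbelianVarietiesComplex, §1.1.3 Lemma 1.1.17 (b); §6.2.4 (PDF p. 310)] [cite: Huybrechts2016K3, Ch. 14 §0.1 (PDF p. 330 L21–L25); Ch. 3 §2.3 (PDF p. 59)] -/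
theorem exists_int_poincarePairing_wedge_self_eq_two_mul (hk : k ≠ 0) (e : Fin n ≃ ι) {m : ℕ} (hn : k + (m + k) = n)
    {x : E [⋀^Fin k]→L[ℝ] ℂ} (hx : x ∈ integralForms Φ k) {γ : E [⋀^Fin m]→L[ℝ] ℂ} (hγ : γ ∈ integralForms Φ m) :
    ∃ c : ℤ, poincarePairing Φ e hn x (γ.wedge x) = 2 * c := by
  obtain hke | hko := Nat.even_or_odd k
  · obtain ⟨y, hy, hxx⟩ := exists_mem_integralForms_wedge_self_eq_two_smul Φ hk hx
    obtain ⟨c, hc⟩ := poincarePairing_mem_range_int Φ e (by omega : (k + k) + m = n) hy hγ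
    exact ⟨c, by rw [poincarePairing_wedge_self_eq_two_mul_of_even Φ hke e hn (by omega) γ hxx, hc]⟩
  · exact ⟨0, by rw [poincarePairing_wedge_self_eq_zero_of_odd Φ hko, Int.cast_zero, mul_zero]⟩

/-- **The Gram matrix `(⟨b_i, γ ∧ b_{i'}⟩)` of a Lefschetz form on any family `b` of integral `k`-classes (`k ≥ 1`, `γ` integral) has EVEN
DIAGONAL**: `2 ∣ G_{ii}`. [cite: Lange2023AbelianVarietiesComplex, §1.1.3 Lemma 1.1.17 (b); §6.2.4 (PDF p. 310)] [cite: Huybrechts2016K3, Ch. 14 §0.1 (PDF p. 330 L21–L25)] -/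
theorem two_dvd_of_eq_poincarePairing_wedge_self (hk : k ≠ 0) (e : Fin n ≃ ι) {m : ℕ} (hn : k + (m + k) = n)
    {γ : E [⋀^Fin m]→L[ℝ] ℂ} (hγ : γ ∈ integralForms Φ m) {μ : Type*} {b : μ → E [⋀^Fin k]→L[ℝ] ℂ} (hb : ∀ i, b i ∈ integralForms Φ k)
    (G : Matrix μ μ ℤ) (hG : ∀ i i', (G i i' : ℂ) = poincarePairing Φ e hn (b i) (γ.wedge (b i'))) (i : μ) : (2 : ℤ) ∣ G i i := by
  obtain ⟨c, hc⟩ := exists_int_poincarePairing_wedge_self_eq_two_mul Φ hk e hn (hb i) hγ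
  refine ⟨c, Int.cast_injective (α := ℂ) ?_⟩
  rw [hG, hc]
  push_cast
  ring

/-- Basis form: on a `ℤ`-basis `b` of `Hᵏ(X, ℤ)` (`k ≥ 1`) the Gram matrix of `(x, y) ↦ ⟨x, γ ∧ y⟩` (`γ` integral) has even diagonal — for
`k` even the symmetric lattice `(Hᵏ(X, ℤ), ⟨·, γ ∧ ·⟩)` is EVEN. [cite: Huybrechts2016K3, Ch. 14 §0.1 (PDF p. 330 L21–L25)] [cite: Lange2023AbelianVarietiesComplex, §6.2.4 (PDF p. 310)] -/
theorem two_dvd_of_basis_eq_poincarePairing_wedge_self (hk : k ≠ 0) (e : Fin n ≃ ι) {m : ℕ} (hn : k + (m + k) = n)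
    {γ : E [⋀^Fin m]→L[ℝ] ℂ} (hγ : γ ∈ integralForms Φ m) {μ : Type*} (b : Basis μ ℤ ↥(integralForms Φ k)) (G : Matrix μ μ ℤ)
    (hG : ∀ i i', (G i i' : ℂ) = poincarePairing Φ e hn (b i : E [⋀^Fin k]→L[ℝ] ℂ) (γ.wedge (b i'))) (i : μ) : (2 : ℤ) ∣ G i i :=
  two_dvd_of_eq_poincarePairing_wedge_self Φ hk e hn hγ (fun i ↦ (b i).2) G hG i

end EvenLattice

/-! ## §3 The integral Lefschetz forms `∫ x ∧ γ_q ∧ y` of a polarised torus take even values on the diagonal -/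

section MinimalClass

variable {ι : Type*} [Fintype ι] [DecidableEq ι] {E : Type*} [NormedAddCommGroup E] [NormedSpace ℂ E]
  (Φ : (ι → ℝ) ≃L[ℝ] E) {j n : ℕ} {e₀ : Fin (j + 2) ⊕ Fin (j + 2) ≃ ι} {η : E [⋀^Fin 2]→L[ℝ] ℝ} {d : Fin (j + 2) → ℕ}

/-- **`∫ x ∧ γ_q ∧ x ∈ 2ℤ` for every `x ∈ Hᵏ(X, ℤ)`, `k ≥ 1`** — polarised torus of type `(d₁, …, d_g)` (`g = j + 2`) in a symplectic
presentation, minimal class `γ_q` (`q ≤ g`, `θ^{∧q} = (q!·d₁⋯d_q)·γ_q`, integral by g40-#6 §1), `k + (2q + k) = 2g`: the integral Lefschetz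
form `(x, y) ↦ ∫ x ∧ γ_q ∧ y` on `Hᵏ(X, ℤ)` is EVEN for `k` even (and alternating for `k` odd); in degree two (`q = g − 2`), with g41-#1 (its
`|disc|`) and g41-#3 (symmetric): `(H²(X, ℤ), ⟨·, γ_{g−2} ∧ ·⟩)` is an even symmetric lattice of `|disc| = (g−1)·∏_{i ≤ g−2} ((d_{g−1}/d_i)(d_g/d_i))^{2g−1}`
— for a principally polarised threefold `∫ θ ∧ x ∧ y` on `H²(X, ℤ) ≅ ℤ^{15}` is even of discriminant `±2`.
[cite: Lange2023AbelianVarietiesComplex, §1.1.3 Lemma 1.1.17 (b); §2.5.3 Cor. 2.5.17 (PDF p. 135); §5.4.1 (5.22) (PDF p. 275); §6.2.4 (PDF p. 310)] [cite: Huybrechts2016K3, Ch. 14 §0.1 (PDF p. 330 L21–L25)] -/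
theorem IsSymplecticEnum.exists_int_poincarePairing_wedge_self_eq_two_mul_of_eq_content_smul (h : IsSymplecticEnum Φ e₀ η d)
    (hη : IsRiemannForm Φ η) {q : ℕ} (hq : q ≤ j + 2) {γ : E [⋀^Fin (2 * q)]→L[ℝ] ℂ}
    (hγ : wedgePow (ofRealForm η) q = ((q.factorial * ∏ i : Fin q, d (Fin.castLE hq i) : ℕ) : ℂ) • γ)
    {k : ℕ} (hk : k ≠ 0) (e : Fin n ≃ ι) (hn : k + (2 * q + k) = n) {x : E [⋀^Fin k]→L[ℝ] ℂ} (hx : x ∈ integralForms Φ k) :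
    ∃ c : ℤ, poincarePairing Φ e hn x (γ.wedge x) = 2 * c :=
  exists_int_poincarePairing_wedge_self_eq_two_mul Φ hk e hn hx (h.mem_integralForms_of_wedgePow_eq_content_smul Φ hη hq hγ)

/-- **The Gram matrix of the Lefschetz form `∫ x ∧ γ_q ∧ y` on a `ℤ`-basis of `Hᵏ(X, ℤ)` has even diagonal** (symplectic presentation,
`g = j + 2`, `k ≥ 1`; g41-#1 computes `|det|` in degrees `1, 2, 3`, g41-#3 symmetry in degree `2`). [cite: Lange2023AbelianVarietiesComplex, §5.4.1 (5.22) (PDF p. 275); §6.2.4 (PDF p. 310)] [cite: Huybrechts2016K3, Ch. 14 §0.1 (PDF p. 330 L21–L25)] -/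
theorem IsSymplecticEnum.two_dvd_of_basis_eq_poincarePairing_wedge_self_of_eq_content_smul (h : IsSymplecticEnum Φ e₀ η d)
    (hη : IsRiemannForm Φ η) {q : ℕ} (hq : q ≤ j + 2) {γ : E [⋀^Fin (2 * q)]→L[ℝ] ℂ}
    (hγ : wedgePow (ofRealForm η) q = ((q.factorial * ∏ i : Fin q, d (Fin.castLE hq i) : ℕ) : ℂ) • γ)
    {k : ℕ} (hk : k ≠ 0) (e : Fin n ≃ ι) (hn : k + (2 * q + k) = n) {μ : Type*} (b : Basis μ ℤ ↥(integralForms Φ k))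
    (G : Matrix μ μ ℤ) (hG : ∀ i i', (G i i' : ℂ) = poincarePairing Φ e hn (b i : E [⋀^Fin k]→L[ℝ] ℂ) (γ.wedge (b i'))) (i : μ) :
    (2 : ℤ) ∣ G i i :=
  two_dvd_of_basis_eq_poincarePairing_wedge_self Φ hk e hn (h.mem_integralForms_of_wedgePow_eq_content_smul Φ hη hq hγ) b G hG i

/-- **Any presentation of a polarised torus of type `(d₁, …, d_g)`: `∫ x ∧ γ_q ∧ x ∈ 2ℤ` for every `x ∈ Hᵏ(X, ℤ)`, `k ≥ 1`** (`g = j + 2`,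
`q ≤ g`; the torus admits a symplectic presentation with the same lattice and `H•(X, ℤ)` depends only on the lattice).
[cite: Lange2023AbelianVarietiesComplex, §1.5.1 (PDF p. 51); §5.4.1 (5.22) (PDF p. 275); §6.2.4 (PDF p. 310)] [cite: Huybrechts2016K3, Ch. 14 §0.1 (PDF p. 330 L21–L25)] -/
theorem IsPolarizationType.exists_int_poincarePairing_wedge_self_eq_two_mul_of_eq_content_smul {Φ : (ι → ℝ) ≃L[ℝ] E}
    (hd : IsPolarizationType Φ η d) (hη : IsRiemannForm Φ η) {q : ℕ} (hq : q ≤ j + 2) {γ : E [⋀^Fin (2 * q)]→L[ℝ] ℂ}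
    (hγ : wedgePow (ofRealForm η) q = ((q.factorial * ∏ i : Fin q, d (Fin.castLE hq i) : ℕ) : ℂ) • γ)
    {k : ℕ} (hk : k ≠ 0) (e : Fin n ≃ ι) (hn : k + (2 * q + k) = n) {x : E [⋀^Fin k]→L[ℝ] ℂ} (hx : x ∈ integralForms Φ k) :
    ∃ c : ℤ, poincarePairing Φ e hn x (γ.wedge x) = 2 * c := by
  obtain ⟨Φ', hΛ, hs⟩ := hd.exists_isSymplecticEnum Φ
  have hγZ : γ ∈ integralForms Φ (2 * q) := by
    rw [integralForms_eq_of_range_latticeVec_eq hΛ.symm (2 * q)]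
    exact hs.mem_integralForms_of_wedgePow_eq_content_smul Φ' (hη.of_range_latticeVec_subset hΛ.le) hq hγ
  exact exists_int_poincarePairing_wedge_self_eq_two_mul Φ hk e hn hx hγZ

/-- **Any presentation: the Gram matrix of `∫ x ∧ γ_q ∧ y` on a `ℤ`-basis of `Hᵏ(X, ℤ)` (`k ≥ 1`) has even diagonal.**
[cite: Lange2023AbelianVarietiesComplex, §1.5.1 (PDF p. 51); §5.4.1 (5.22) (PDF p. 275); §6.2.4 (PDF p. 310)] [cite: Huybrechts2016K3, Ch. 14 §0.1 (PDF p. 330 L21–L25)] -/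
theorem IsPolarizationType.two_dvd_of_basis_eq_poincarePairing_wedge_self_of_eq_content_smul {Φ : (ι → ℝ) ≃L[ℝ] E}
    (hd : IsPolarizationType Φ η d) (hη : IsRiemannForm Φ η) {q : ℕ} (hq : q ≤ j + 2) {γ : E [⋀^Fin (2 * q)]→L[ℝ] ℂ}
    (hγ : wedgePow (ofRealForm η) q = ((q.factorial * ∏ i : Fin q, d (Fin.castLE hq i) : ℕ) : ℂ) • γ)
    {k : ℕ} (hk : k ≠ 0) (e : Fin n ≃ ι) (hn : k + (2 * q + k) = n) {μ : Type*} (b : Basis μ ℤ ↥(integralForms Φ k))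
    (G : Matrix μ μ ℤ) (hG : ∀ i i', (G i i' : ℂ) = poincarePairing Φ e hn (b i : E [⋀^Fin k]→L[ℝ] ℂ) (γ.wedge (b i'))) (i : μ) :
    (2 : ℤ) ∣ G i i := by
  obtain ⟨Φ', hΛ, hs⟩ := hd.exists_isSymplecticEnum Φ
  have hγZ : γ ∈ integralForms Φ (2 * q) := by
    rw [integralForms_eq_of_range_latticeVec_eq hΛ.symm (2 * q)]
    exact hs.mem_integralForms_of_wedgePow_eq_content_smul Φ' (hη.of_range_latticeVec_subset hΛ.le) hq hγ
  exact two_dvd_of_basis_eq_poincarePairing_wedge_self Φ hk e hn hγZ b G hG i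

/-- **Existence form**: any polarised torus of type `(d₁, …, d_g)` (`g = j + 2`) carries, for each `q ≤ g`, the integral minimal class `γ_q`
whose Lefschetz form `∫ x ∧ γ_q ∧ y` takes even values `∫ x ∧ γ_q ∧ x ∈ 2ℤ` on `Hᵏ(X, ℤ)` (`k ≥ 1`, `k + (2q + k) = 2g`).
[cite: Lange2023AbelianVarietiesComplex, §2.5.3 Thm. 2.5.16 and Cor. 2.5.17 (PDF p. 135); §5.4.1 (5.22) (PDF p. 275)] [cite: Huybrechts2016K3, Ch. 14 §0.1 (PDF p. 330 L21–L25)] -/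
theorem IsPolarizationType.exists_minimalClass_poincarePairing_wedge_self_even {Φ : (ι → ℝ) ≃L[ℝ] E}
    (hd : IsPolarizationType Φ η d) (hη : IsRiemannForm Φ η) {q : ℕ} (hq : q ≤ j + 2) {k : ℕ} (hk : k ≠ 0) (e : Fin n ≃ ι)
    (hn : k + (2 * q + k) = n) :
    ∃ γ ∈ integralForms Φ (2 * q), wedgePow (ofRealForm η) q = ((q.factorial * ∏ i : Fin q, d (Fin.castLE hq i) : ℕ) : ℂ) • γ ∧
      ∀ x ∈ integralForms Φ k, ∃ c : ℤ, poincarePairing Φ e hn x (γ.wedge x) = 2 * c := by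
  obtain ⟨γ, hγZ, hγ⟩ := hd.exists_mem_integralForms_wedgePow_eq_content_smul hq
  exact ⟨γ, hγZ, hγ, fun x hx ↦ hd.exists_int_poincarePairing_wedge_self_eq_two_mul_of_eq_content_smul hη hq hγ hk e hn hx⟩

end MinimalClass

end Literature.Geometry.Kaehler.ComplexTorus
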